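import Mathlib
import Summits.KontsevichZagierPeriods.Zeta5Search.CollinearityGuardProof
import Summits.KontsevichZagierPeriods.Zeta5Search.SmallPrimeDominance
import Summits.KontsevichZagierPeriods.Zeta5Search.RecordCellDClassDataProof
import Summits.KontsevichZagierPeriods.Zeta5Search.CellKitRays
import HarnessLib

/-!
# ζ(5) search — CELL KIT, part 7: the AFFINE cells (two orbit types, `N` odd) via the COLLINEARITY CRITERION

Cell `pub-zeta5` (HONEST FRAMING: systematic search; no irrationality claim unless certified), P1 prover seat generation 8.
The machine-generated first-digit atlases (`Atlas/*`, `AtlasCellRec*`) establish, for a θ-cell of a linear ray and every prime of the cell: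
(i) every residue class has exponent `≥ -N`, (ii) the level-`-N` classes avoid the centre and (iii) their TYPES (exponent vectors) belong to an
explicit finite list.  When that list consists of at most two types up to reversal and `N` is odd, census g17's structural guard of the
COLLINEARITY CRITERION (typer g10: `collinearityCriterion_holds`, `ccOrbitTypeCorollary`, `casLB_succ_le_of_ccGuard`) applies: two orbit vectors
always lie on one affine line of `𝔽_p²`, and with `p` in the moment range the first Casoratian digit vanishes.  This file packages that route
DIGIT-FREE: `affine_bound` — hypotheses (i)–(iii), a witness multipole class at level `-N`, `N` odd, the moment range; conclusion
`v_p(Cas_j(b)) ≥ (3 − 2N) + 1`.  Ingredients: `keyCount ≤ 2` when every key is `sameKey`-related to one of two keys (`keyCount_le_two`),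
`3 − 2N ≤ casLB` from `casLB_ge_or_noPole`.  Valuations of rationals; nothing about irrationality.
-/

open Finset

namespace Summit.KontsevichZagierPeriods.Zeta5Search.CellKit

open Summit.KontsevichZagierPeriods.Zeta5Search.CasoratianValuation (InPolytope shift casoratian)
open Summit.KontsevichZagierPeriods.Zeta5Search.WedgeDictionary (dOf)
open Summit.KontsevichZagierPeriods.Zeta5Search.ClusterValuation
open Summit.KontsevichZagierPeriods.Zeta5Search.CellA (classExp_le_classNu)

/-! ### §1 Counting orbit types: at most one / two keys -/

/-- If every key of `l` is `sameKey`-related to `K`, then `keyCount l ≤ 1`. -/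
theorem keyCount_le_one {l : List (Bool × List ℤ)} {K : Bool × List ℤ} (h : ∀ w ∈ l, sameKey w K = true) : keyCount l ≤ 1 := by
  induction l with
  | nil => simp [keyCount]
  | cons u us ih =>
    have hu : sameKey u K = true := h u (by simp)
    have hus : ∀ w ∈ us, sameKey w K = true := fun w hw => h w (by simp [hw])
    rcases us with _ | ⟨v, vs⟩
    · simp [keyCount]
    · have hv : sameKey v K = true := hus v (by simp)
      have huv : sameKey u v = true := sameKey_trans hu (sameKey_symm hv)
      have hany : (v :: vs).any (fun w => sameKey u w) = true := List.any_eq_true.2 ⟨v, by simp, huv⟩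
      show (if (v :: vs).any (fun w => sameKey u w) then 0 else 1) + keyCount (v :: vs) ≤ 1
      rw [if_pos hany, zero_add]
      exact ih hus

/-- If every key of `l` is `sameKey`-related to `K₁` or to `K₂`, then `keyCount l ≤ 2`. -/
theorem keyCount_le_two {l : List (Bool × List ℤ)} {K₁ K₂ : Bool × List ℤ}
    (h : ∀ w ∈ l, sameKey w K₁ = true ∨ sameKey w K₂ = true) : keyCount l ≤ 2 := by
  induction l with
  | nil => simp [keyCount]
  | cons u us ih =>
    have hus : ∀ w ∈ us, sameKey w K₁ = true ∨ sameKey w K₂ = true := fun w hw => h w (by simp [hw])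
    show (if us.any (fun w => sameKey u w) then 0 else 1) + keyCount us ≤ 2
    by_cases hany : us.any (fun w => sameKey u w) = true
    · rw [if_pos hany, zero_add]; exact ih hus
    · rw [if_neg hany]
      -- no element of `us` is related to `u`; `u ~ K` for `K ∈ {K₁, K₂}`, so every element of `us` is related to the other key
      have hu := h u (by simp)
      have hnot : ∀ w ∈ us, sameKey u w = false := by
        intro w hw
        by_contra hc
        exact hany (List.any_eq_true.2 ⟨w, hw, by simpa using hc⟩)
      rcases hu with hu | hu
      · have : ∀ w ∈ us, sameKey w K₂ = true := by
          intro w hw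
          rcases hus w hw with hw1 | hw2
          · exact absurd (sameKey_trans hu (sameKey_symm hw1)) (by simp [hnot w hw])
          · exact hw2
        have := keyCount_le_one this; omega
      · have : ∀ w ∈ us, sameKey w K₁ = true := by
          intro w hw
          rcases hus w hw with hw1 | hw2
          · exact hw1
          · exact absurd (sameKey_trans hu (sameKey_symm hw2)) (by simp [hnot w hw])
        have := keyCount_le_one this; omega

/-- A non-centre key with vector `T` or `T.reverse` is `sameKey`-related to `(false, T)`. -/
theorem sameKey_of_vec {T v : List ℤ} (h : v = T ∨ v = T.reverse) : sameKey (false, v) (false, T) = true := by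
  rcases h with rfl | rfl <;> simp [sameKey]

/-! ### §2 The level vector from a type -/

section LV
variable {p : ℕ} [hp : Fact p.Prime] (b : ℕ → ℤ) {x L : ℕ} (hx : x < p) (hL : x + L * p ≤ (b 0).toNat)
  (hL' : (b 0).toNat < x + L * p + p)
include hx hL hL'

/-- The level vector of a typed level class is the list of the type's values. -/
theorem levelVec_of_type (e : ℕ → ℤ) (he : ∀ k ≤ L, netExp b (x + k * p) = e k) :
    levelVec b p x = (List.range (L + 1)).map e := by
  rw [levelVec_level b hx hL hL']
  refine List.map_congr_left ?_
  intro k hk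
  exact he k (by have := List.mem_range.1 hk; omega)

end LV

/-- `d` on a linear ray: `dOf (bLin a e n) = 15n + 3e − a`. -/
theorem dOf_bLin (a e n : ℕ) : dOf (bLin a e n) = 15 * (n : ℤ) + 3 * e - a := by
  simp only [dOf, Finset.sum_range_succ, Finset.sum_range_zero]
  rw [bLin_zero, bLin_succ a e n 0 (by norm_num), bLin_succ a e n 1 (by norm_num), bLin_succ a e n 2 (by norm_num),
    bLin_succ a e n 3 (by norm_num), bLin_succ a e n 4 (by norm_num), bLin_succ a e n 5 (by norm_num), bLin_succ a e n 6 (by norm_num)]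
  push_cast
  ring

/-! ### §3 The affine bound -/

variable {p : ℕ} [hp : Fact p.Prime]

/-- **AFFINE CELLS via the collinearity criterion (digit-free).**  Let every class have exponent `≥ -N` (`N ≥ 3` odd), let a multipole class
attain `-N`, let the level-`-N` classes avoid the centre and have exponent vectors among `T₁, T₁ʳᵉᵛ, T₂, T₂ʳᵉᵛ`, and let `p` lie in the moment
range `(N−1)p + 2 ≤ 2d + 3` (`p ≤ b₀`, `p ≤ d`, `b₀ + 2 < p²`).  Then `v_p(Cas_j(b)) ≥ (3 − 2N) + 1`. -/
theorem affine_bound (b : ℕ → ℤ) (hb : InPolytope b) {j : ℕ} (hj1 : 1 ≤ j) (hj7 : j ≤ 7) (hb' : InPolytope (shift b j))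
    (hp5 : 5 ≤ p) (hpb : (p : ℤ) ≤ b 0) (hpd : (p : ℤ) ≤ dOf b) (hwin : (b 0 + 2 : ℤ) < (p : ℤ) ^ 2)
    {N : ℕ} (hN3 : 3 ≤ N) (hNodd : N % 2 = 1) (hrange : ((N : ℤ) - 1) * p + 2 ≤ 2 * dOf b + 3)
    (hmin : ∀ x, x < p → -(N : ℤ) ≤ classExp b p x)
    (hwit : ∃ x ∈ multipoleClasses b p, classExp b p x = -(N : ℤ))
    (T₁ T₂ : List ℤ)
    (htypes : ∀ x ∈ deepClasses b p N, ¬ CentreIn b p x ∧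
      (levelVec b p x = T₁ ∨ levelVec b p x = T₁.reverse ∨ levelVec b p x = T₂ ∨ levelVec b p x = T₂.reverse))
    (hne : casoratian b j ≠ 0) : 3 - 2 * (N : ℤ) + 1 ≤ padicValRat p (casoratian b j) := by
  -- the orbit-type count is at most two
  have hcount : ccCount b p N ≤ 2 := by
    unfold ccCount
    apply keyCount_le_two (K₁ := (false, T₁)) (K₂ := (false, T₂))
    intro w hw
    obtain ⟨x, hx, rfl⟩ := List.mem_map.1 hw
    have hxD : x ∈ deepClasses b p N := (mem_ccLive_iff.1 hx).1
    obtain ⟨hc, hv⟩ := htypes x hxD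
    have hdec : decide (CentreIn b p x) = false := decide_eq_false hc
    rw [hdec]
    rcases hv with h | h | h | h
    · exact Or.inl (sameKey_of_vec (Or.inl h))
    · exact Or.inl (sameKey_of_vec (Or.inr h))
    · exact Or.inr (sameKey_of_vec (Or.inl h))
    · exact Or.inr (sameKey_of_vec (Or.inr h))
  -- the guard
  have hguard : ccGuard b p N = true := by
    have hR : ccRegime b p N = true := decide_eq_true ⟨hmin, hwit⟩
    have hk : decide (ccCount b p N ≤ 1) = true ∨
        ((N % 2 == 1) && (ccCount b p N == 2) && decide (((N : ℤ) - 1) * p + 2 ≤ 2 * dOf b + 3)) = true := by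
      rcases Nat.lt_or_ge (ccCount b p N) 2 with hlt | hge
      · exact Or.inl (decide_eq_true (by omega))
      · right
        have h2 : ccCount b p N = 2 := le_antisymm hcount hge
        simp [hNodd, h2, hrange]
    unfold ccGuard
    rw [hR, decide_eq_true hN3]
    simpa using hk
  have hcrit := casLB_succ_le_of_ccGuard b p j N hb hb' hj1 hj7 hp.out hp5 hpb hpd hwin hguard hne
  -- `casLB ≥ 3 − 2N` (or there is no pole class at all, `casLB = 0`)
  have hLB := casLB_ge_or_noPole b p (-(N : ℤ)) (3 - (N : ℤ))
    (fun x hx _ => (hmin x hx).trans (classExp_le_classNu b p x)) (by omega)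
    (fun x hx _ => by have := hmin x hx; omega) (fun _ => by omega)
  rcases hLB with ⟨h0, -⟩ | hge
  · rw [h0] at hcrit; omega
  · omega

/-- **AFFINE CELLS, typed form**: as `affine_bound`, with the level-`-N` classes described by TYPES `e` (functions `ℕ → ℤ` on `k ≤ L`)
whose value lists are among `T₁, T₁ʳᵉᵛ, T₂, T₂ʳᵉᵛ` — the form produced by the machine-generated atlases. -/
theorem affine_bound_typed (b : ℕ → ℤ) (hb : InPolytope b) {j : ℕ} (hj1 : 1 ≤ j) (hj7 : j ≤ 7) (hb' : InPolytope (shift b j))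
    (hp5 : 5 ≤ p) (hpb : (p : ℤ) ≤ b 0) (hpd : (p : ℤ) ≤ dOf b) (hwin : (b 0 + 2 : ℤ) < (p : ℤ) ^ 2)
    {N : ℕ} (hN3 : 3 ≤ N) (hNodd : N % 2 = 1) (hrange : ((N : ℤ) - 1) * p + 2 ≤ 2 * dOf b + 3)
    (hmin : ∀ x, x < p → -(N : ℤ) ≤ classExp b p x)
    (hwit : ∃ x ∈ multipoleClasses b p, classExp b p x = -(N : ℤ))
    (T₁ T₂ : List ℤ)
    (htypes : ∀ x, x < p → classExp b p x = -(N : ℤ) → ¬ CentreIn b p x ∧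
      ∃ (L : ℕ) (e : ℕ → ℤ), x + L * p ≤ (b 0).toNat ∧ (b 0).toNat < x + L * p + p ∧ (∀ k ≤ L, netExp b (x + k * p) = e k) ∧
        ((List.range (L + 1)).map e = T₁ ∨ (List.range (L + 1)).map e = T₁.reverse ∨
         (List.range (L + 1)).map e = T₂ ∨ (List.range (L + 1)).map e = T₂.reverse))
    (hne : casoratian b j ≠ 0) : 3 - 2 * (N : ℤ) + 1 ≤ padicValRat p (casoratian b j) := by
  refine affine_bound b hb hj1 hj7 hb' hp5 hpb hpd hwin hN3 hNodd hrange hmin hwit T₁ T₂ ?_ hne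
  intro x hxD
  obtain ⟨hxp, hE⟩ := Finset.mem_filter.1 hxD
  have hx : x < p := Finset.mem_range.1 hxp
  obtain ⟨hc, L, e, hL, hL', he, hT⟩ := htypes x hx hE
  refine ⟨hc, ?_⟩
  rw [levelVec_of_type b hx hL hL' e he]
  exact hT

end Summit.KontsevichZagierPeriods.Zeta5Search.CellKit
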